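import Mathlib.LinearAlgebra.TensorProduct.Map
import Mathlib.Algebra.CharP.Invertible
import HarnessLib

/-!
# Degree two of a connected, cocommutative bialgebra without degree-two primitives is spanned by products of
# degree-one classes — the linear algebra behind «`H²(A, 𝒪_A) = H¹ ∪ H¹`» for an abelian variety
# (Milnor–Moore, *On the structure of Hopf algebras*, Prop. 4.17–4.20; Görtz–Wedhorn II, Cor. 27.200)

For an abelian variety `A` over a field of characteristic `0` the coherent cohomology `H• = ⊕ₙ Hⁿ(A, 𝒪_A)` is a
graded-commutative, graded-COcommutative connected bialgebra (cup product; coproduct `m^*` read through the Künneth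
isomorphism; `m ∘ sw = m`), and [GortzWedhorn2023, Cor. 27.200] (= [MumfordAV1970, §13 Cor. 2]) says that the
canonical map `Λ• H¹ → H•` is an isomorphism; in particular **the cup product `H¹ ⊗ H¹ → H²` is onto**.  Print proves this
through the Borel–Hopf structure theorem together with `dim H¹ = dim A` and `Hⁿ = 0` for `n > dim A`.  This file isolates
the DEGREE-TWO statement as pure linear algebra with none of those inputs — it is the degree-`2` instance of
[MilnorMoore1965, Prop. 4.17 and 4.20] («for a connected, commutative and cocommutative Hopf algebra over a field of
characteristic `0` the primitives map isomorphically onto the indecomposables»):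

* DATA: `k`-modules `V` («`H¹`») and `W` («`H²`»), the cup product `cup : V ⊗ V → W`, and the REDUCED COPRODUCT
  `μ : W → V ⊗ V` (the `H¹ ⊗ H¹`-Künneth component of `m^*x − x×1 − 1×x`);
* HYPOTHESES: (h1) `μ (cup (a ⊗ b)) = a ⊗ b − b ⊗ a` (multiplicativity of `m^*`, primitivity of degree-one classes and
  `p₂^*a ∪ p₁^*b = −(b × a)`); (h2) `μ x` is ANTISYMMETRIC, `τ(μ x) = −μ x` (cocommutativity `m ∘ sw = m` and
  `sw^*(a × b) = −(b × a)`); (h3) NO PRIMITIVES in degree two: `μ x = 0 → x = 0` (the tree's F-11 residual (iv), A. Grothendieck's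
  unobstructedness input, from Künneth injectivity and the nilpotent-primitive lemma); `2` invertible in `k`;
* CONCLUSION: **`x = ⅟2 • cup (μ x)`** for every `x : W` (`eq_half_cup_reducedCoproduct`), hence `cup` is onto
  (`cup_surjective`, `range_cup_eq_top`), and every endomorphism pair `(φ, ψ)` of `(V, W)` compatible with `cup` and with
  `φ = n` acts on `W` as `n²` (`eq_sq_smul_of_comp_cup`) — so a class `x` with `ψ x = n • x` for `n = 2` vanishes
  (`eq_zero_of_two_smul`: the shape of «`[n]^*c = n·c ∀ n ⇒ c = 0` on `H²`»).

PROOF of the main statement: by (h1) extended linearly, `μ (cup t) = t − τ t` for all `t ∈ V ⊗ V`; with `t := μ x`,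
(h2) gives `μ (x − ⅟2 • cup t) = t − ⅟2 • (t + t) = 0`, so (h3) forces `x = ⅟2 • cup (μ x)`.

Everything here is proved; no definition, no named fact, no `sorry`; Mathlib only.  The geometric instantiation (Čech
cohomology of `𝒪_A`, Künneth, pull-backs) is NOT in this file.  Library only (cell hodgecm-mathlib, FLOOR-0 P1 sub-line
F-11 road A, job J3 of `F0/P1b/JOIN-BRIEF-F11.v0`); HC_CM is proved only modulo the 7 printed citations until rung 0
closes, and nothing here bears on it.

## References

* [MilnorMoore1965] J. W. Milnor, J. C. Moore, *On the structure of Hopf algebras*, Ann. of Math. (2) 81 (1965)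
  211–264: §4, Prop. 4.17, Prop. 4.20 (primitives versus indecomposables in characteristic `0`).
* [GortzWedhorn2023] U. Görtz, T. Wedhorn, *Algebraic Geometry II* (2023): Thm. 27.78 (Borel–Hopf), Cor. 27.79–27.80,
  Cor. 27.200 (`Λ• H¹(X, 𝒪_X) ≅ H•(X, 𝒪_X)` for an abelian variety).
* [MumfordAV1970] D. Mumford, *Abelian Varieties* (1970), §13 Cor. 2 (p. 129).
-/

open scoped TensorProduct

namespace Literature.Algebra.Bialgebra

variable {k : Type*} [CommRing k] {V W : Type*} [AddCommGroup V] [Module k V] [AddCommGroup W] [Module k W]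

/-- **The reduced coproduct of a product of two degree-one classes, linear form.**  If
`μ (cup (a ⊗ b)) = a ⊗ b − b ⊗ a` on pure tensors, then `μ (cup t) = t − τ t` for every `t ∈ V ⊗ V`
(`τ` = `TensorProduct.comm`). [cite: MilnorMoore1965, §4 Prop. 4.17] -/
theorem reducedCoproduct_cup_eq_sub_comm (cup : V ⊗[k] V →ₗ[k] W) (μ : W →ₗ[k] V ⊗[k] V)
    (h1 : ∀ a b : V, μ (cup (a ⊗ₜ b)) = a ⊗ₜ b - b ⊗ₜ a) (t : V ⊗[k] V) :
    μ (cup t) = t - TensorProduct.comm k V V t := by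
  induction t using TensorProduct.induction_on with
  | zero => simp
  | tmul a b => rw [h1, TensorProduct.comm_tmul]
  | add s t hs ht => rw [map_add, map_add, hs, ht, map_add]; abel

/-- **Degree two is spanned by cups of degree-one classes (Milnor–Moore in degree `2`).**  Let `cup : V ⊗ V → W` and
`μ : W → V ⊗ V` satisfy (h1) `μ (cup (a ⊗ b)) = a ⊗ b − b ⊗ a`, (h2) `τ (μ x) = −μ x` (cocommutativity) and (h3)
`μ x = 0 → x = 0` (no degree-two primitives), with `2` invertible in `k`.  Then every `x : W` is
`x = ⅟2 • cup (μ x)`; in the application `W = H²(A, 𝒪_A)`, `V = H¹(A, 𝒪_A)` for an abelian variety `A` over a field of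
characteristic `0`, this is «`H² = H¹ ∪ H¹`» ([GortzWedhorn2023, Cor. 27.200]) without Borel–Hopf, `dim H¹ = g` or
`H^{>g} = 0`. [cite: MilnorMoore1965, §4 Prop. 4.20] -/
theorem eq_half_cup_reducedCoproduct [Invertible (2 : k)] (cup : V ⊗[k] V →ₗ[k] W) (μ : W →ₗ[k] V ⊗[k] V)
    (h1 : ∀ a b : V, μ (cup (a ⊗ₜ b)) = a ⊗ₜ b - b ⊗ₜ a)
    (h2 : ∀ x : W, TensorProduct.comm k V V (μ x) = -μ x)
    (h3 : ∀ x : W, μ x = 0 → x = 0) (x : W) :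
    x = (⅟(2 : k)) • cup (μ x) := by
  have key : μ (x - (⅟(2 : k)) • cup (μ x)) = 0 := by
    rw [map_sub, map_smul, reducedCoproduct_cup_eq_sub_comm cup μ h1, h2, sub_neg_eq_add, ← two_smul k (μ x),
      smul_smul, invOf_mul_self, one_smul, sub_self]
  exact sub_eq_zero.mp (h3 _ key)

/-- **`cup : V ⊗ V → W` is onto** under (h1)–(h3) and `2` invertible — the cup product
`H¹(A, 𝒪_A) ⊗ H¹(A, 𝒪_A) → H²(A, 𝒪_A)` of an abelian variety in characteristic `0` is surjective.
[cite: GortzWedhorn2023, Cor. 27.200] -/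
theorem cup_surjective [Invertible (2 : k)] (cup : V ⊗[k] V →ₗ[k] W) (μ : W →ₗ[k] V ⊗[k] V)
    (h1 : ∀ a b : V, μ (cup (a ⊗ₜ b)) = a ⊗ₜ b - b ⊗ₜ a)
    (h2 : ∀ x : W, TensorProduct.comm k V V (μ x) = -μ x)
    (h3 : ∀ x : W, μ x = 0 → x = 0) : Function.Surjective cup :=
  fun x => ⟨(⅟(2 : k)) • μ x, by rw [map_smul]; exact (eq_half_cup_reducedCoproduct cup μ h1 h2 h3 x).symm⟩

/-- Range form of `cup_surjective`: `range cup = ⊤`. [cite: GortzWedhorn2023, Cor. 27.200] -/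
theorem range_cup_eq_top [Invertible (2 : k)] (cup : V ⊗[k] V →ₗ[k] W) (μ : W →ₗ[k] V ⊗[k] V)
    (h1 : ∀ a b : V, μ (cup (a ⊗ₜ b)) = a ⊗ₜ b - b ⊗ₜ a)
    (h2 : ∀ x : W, TensorProduct.comm k V V (μ x) = -μ x)
    (h3 : ∀ x : W, μ x = 0 → x = 0) : LinearMap.range cup = ⊤ :=
  LinearMap.range_eq_top.mpr (cup_surjective cup μ h1 h2 h3)

/-- Span form of `cup_surjective`: `W` is spanned by the cups `cup (a ⊗ b)` of PURE tensors (the classes `a ∪ b`,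
`a, b ∈ H¹`). [cite: GortzWedhorn2023, Cor. 27.200] -/
theorem span_cup_tmul_eq_top [Invertible (2 : k)] (cup : V ⊗[k] V →ₗ[k] W) (μ : W →ₗ[k] V ⊗[k] V)
    (h1 : ∀ a b : V, μ (cup (a ⊗ₜ b)) = a ⊗ₜ b - b ⊗ₜ a)
    (h2 : ∀ x : W, TensorProduct.comm k V V (μ x) = -μ x)
    (h3 : ∀ x : W, μ x = 0 → x = 0) :
    Submodule.span k (Set.range fun ab : V × V => cup (ab.1 ⊗ₜ ab.2)) = ⊤ := by
  rw [eq_top_iff]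
  rintro x -
  obtain ⟨t, rfl⟩ := cup_surjective cup μ h1 h2 h3 x
  induction t using TensorProduct.induction_on with
  | zero => rw [map_zero]; exact Submodule.zero_mem _
  | tmul a b => exact Submodule.subset_span ⟨(a, b), rfl⟩
  | add s t hs ht => rw [map_add]; exact Submodule.add_mem _ hs ht

/-! ### Endomorphisms compatible with the cup product: `[n]^* = n²` on degree two -/

/-- **An endomorphism pair `(φ, ψ)` of `(V, W)` compatible with `cup` and with `φ = n • id` acts on `W` as `n²`** —
under (h1)–(h3): `x = ⅟2 • cup (μ x)`, so `ψ x = ⅟2 • cup ((φ ⊗ φ)(μ x)) = n² • x`.  Application: `[n]_A^* = n` on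
`H¹(A, 𝒪_A)` (degree-one classes are primitive), `[n]^*` is multiplicative, hence `[n]_A^* = n²` on `H²(A, 𝒪_A)`.
[cite: MumfordAV1970, §13 Cor. 2 (p. 129)] -/
theorem eq_sq_smul_of_comp_cup [Invertible (2 : k)] (cup : V ⊗[k] V →ₗ[k] W) (μ : W →ₗ[k] V ⊗[k] V)
    (h1 : ∀ a b : V, μ (cup (a ⊗ₜ b)) = a ⊗ₜ b - b ⊗ₜ a)
    (h2 : ∀ x : W, TensorProduct.comm k V V (μ x) = -μ x)
    (h3 : ∀ x : W, μ x = 0 → x = 0)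
    (φ : V →ₗ[k] V) (ψ : W →ₗ[k] W) (hψ : ψ ∘ₗ cup = cup ∘ₗ TensorProduct.map φ φ)
    (n : k) (hφ : ∀ a : V, φ a = n • a) (x : W) : ψ x = (n * n) • x := by
  have hmap : ∀ t : V ⊗[k] V, TensorProduct.map φ φ t = (n * n) • t := by
    intro t
    induction t using TensorProduct.induction_on with
    | zero => simp
    | tmul a b => rw [TensorProduct.map_tmul, hφ, hφ, TensorProduct.smul_tmul_smul]
    | add s t hs ht => rw [map_add, hs, ht, smul_add]
  have hx := eq_half_cup_reducedCoproduct cup μ h1 h2 h3 x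
  have hψc : ∀ t, ψ (cup t) = cup (TensorProduct.map φ φ t) := fun t => by
    simpa using LinearMap.congr_fun hψ t
  calc ψ x = ψ ((⅟(2 : k)) • cup (μ x)) := by rw [← hx]
    _ = (⅟(2 : k)) • cup ((n * n) • μ x) := by rw [map_smul, hψc, hmap]
    _ = (n * n) • ((⅟(2 : k)) • cup (μ x)) := by rw [map_smul, smul_comm]
    _ = (n * n) • x := by rw [← hx]

/-- **«`[2]^*x = 2 • x` on `H²` forces `x = 0`»** — with (h1)–(h3) and `(φ, ψ)` compatible with `cup`, `φ = 2 • id`: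
`ψ x = 4 • x`, so `ψ x = 2 • x` gives `2 • x = 0`, i.e. `x = 0` (`2` invertible).  This is the degree-two case of the
F-11 letter «`[n]_A^* c = n·c` for all `n` ⇒ `c = 0` on `H²(A, 𝒪_A)`» (abelian schemes are unobstructed, char `0`).
[cite: MumfordAV1970, §13 Cor. 2 (p. 129)] -/
theorem eq_zero_of_two_smul [Invertible (2 : k)] (cup : V ⊗[k] V →ₗ[k] W) (μ : W →ₗ[k] V ⊗[k] V)
    (h1 : ∀ a b : V, μ (cup (a ⊗ₜ b)) = a ⊗ₜ b - b ⊗ₜ a)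
    (h2 : ∀ x : W, TensorProduct.comm k V V (μ x) = -μ x)
    (h3 : ∀ x : W, μ x = 0 → x = 0)
    (φ : V →ₗ[k] V) (ψ : W →ₗ[k] W) (hψ : ψ ∘ₗ cup = cup ∘ₗ TensorProduct.map φ φ)
    (hφ : ∀ a : V, φ a = (2 : k) • a) {x : W} (hx : ψ x = (2 : k) • x) : x = 0 := by
  have h4 : ψ x = ((2 : k) * 2) • x := eq_sq_smul_of_comp_cup cup μ h1 h2 h3 φ ψ hψ 2 hφ x
  have h22 : ((2 : k) * 2) • x = (2 : k) • x + (2 : k) • x := by rw [mul_smul, two_smul]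
  have h2x : (2 : k) • x = 0 := by
    have := hx.symm.trans h4
    rw [h22] at this
    exact (add_eq_left.mp this.symm)
  have := congrArg (fun y => (⅟(2 : k)) • y) h2x
  simpa [smul_smul, invOf_mul_self] using this

/-! ### Primitive elements: the «no degree-two primitives» hypothesis in its usual dress -/

/-- (h3) from the PRIMITIVE form: if the full coproduct `Δ : W → W₂` of degree two decomposes as
`Δ x = ι₁ x + κ (μ x) + ι₂ x` with `κ` injective on `V ⊗ V` («Künneth»), and `x` primitive (`Δ x = ι₁ x + ι₂ x`) forces
`x = 0`, then `μ x = 0 → x = 0`.  (Bookkeeping only; lets the consumer feed A-p04's «no non-zero primitive class in `H²`»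
verbatim.) [cite: MilnorMoore1965, §4 Prop. 4.17] -/
theorem reducedCoproduct_eq_zero_imp {W₂ : Type*} [AddCommGroup W₂] [Module k W₂]
    (Δ ι₁ ι₂ : W →ₗ[k] W₂) (κ : V ⊗[k] V →ₗ[k] W₂) (μ : W →ₗ[k] V ⊗[k] V)
    (hΔ : ∀ x : W, Δ x = ι₁ x + κ (μ x) + ι₂ x)
    (hprim : ∀ x : W, Δ x = ι₁ x + ι₂ x → x = 0) (x : W) (hx : μ x = 0) : x = 0 :=
  hprim x (by rw [hΔ, hx, map_zero, add_zero])

/-- (h2) from COCOMMUTATIVITY: if an involution `σ` of `W₂` («`sw^*`») fixes `Δ x`, exchanges `ι₁` and `ι₂`, and acts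
on the Künneth part by `σ (κ t) = −κ (τ t)` («`sw^*(a × b) = −(b × a)`», degree-`(1,1)` commutativity), with `κ`
injective, then `τ (μ x) = −μ x`. [cite: MilnorMoore1965, §4 Prop. 4.20] -/
theorem comm_reducedCoproduct_eq_neg {W₂ : Type*} [AddCommGroup W₂] [Module k W₂]
    (Δ ι₁ ι₂ : W →ₗ[k] W₂) (κ : V ⊗[k] V →ₗ[k] W₂) (μ : W →ₗ[k] V ⊗[k] V) (σ : W₂ →ₗ[k] W₂)
    (hΔ : ∀ x : W, Δ x = ι₁ x + κ (μ x) + ι₂ x) (hκ : Function.Injective κ)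
    (hσΔ : ∀ x : W, σ (Δ x) = Δ x) (hσ₁ : ∀ x : W, σ (ι₁ x) = ι₂ x) (hσ₂ : ∀ x : W, σ (ι₂ x) = ι₁ x)
    (hσκ : ∀ t : V ⊗[k] V, σ (κ t) = -κ (TensorProduct.comm k V V t)) (x : W) :
    TensorProduct.comm k V V (μ x) = -μ x := by
  have h := hσΔ x
  rw [hΔ, map_add, map_add, hσ₁, hσ₂, hσκ] at h
  -- `ι₂ x - κ (τ μ x) + ι₁ x = ι₁ x + κ (μ x) + ι₂ x`
  have h' : κ (-(TensorProduct.comm k V V (μ x))) = κ (μ x) := by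
    rw [map_neg]
    -- both sides of `h` reduce to the `κ`-terms after subtracting `ι₁ x + ι₂ x`
    have e : ι₂ x + -κ ((TensorProduct.comm k V V) (μ x)) + ι₁ x - (ι₁ x + κ (μ x) + ι₂ x) =
        -κ ((TensorProduct.comm k V V) (μ x)) - κ (μ x) := by abel
    have h0 : ι₂ x + -κ ((TensorProduct.comm k V V) (μ x)) + ι₁ x - (ι₁ x + κ (μ x) + ι₂ x) = 0 :=
      sub_eq_zero.mpr h
    rw [e] at h0
    exact sub_eq_zero.mp h0
  have := hκ h'
  rw [neg_eq_iff_eq_neg] at this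
  exact this

end Literature.Algebra.Bialgebra
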